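import Summits.HodgeConjecture.HodgeConjecture.Theses.CurveNetMordellWeil
import Summits.HodgeConjecture.HodgeConjecture.Theorems.CurveNetMordellWeilCurveNetExistsTransfer
import Literature.AlgebraicGeometry.Motives.CurveNet
import Literature.AlgebraicGeometry.Motives.CurveNetExistence
import Literature.AlgebraicGeometry.HodgeTheory.HodgeModelExistence
import HarnessLib

/-!
# `CurveNetExists` (route CurveNetMordellWeil, support item stmt-HodgeConjecture-2788) from the
existence of curve nets and Hodge models

The route item `CurveNetExists` asks, for every smooth projective complex `X` of dimension
`n = m + 1 ≥ 2` and every orientation family `μ` with Poincaré duality, for a smooth projective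
`X'` of dimension `n`, a morphism `σ : X' ⟶ X` and a SURJECTIVE `pr : X' ⟶ ℙᵐ` such that, in every
degree `2q`, the `ℂ`-span of the rational `(q,q)`-classes of `X` lies in `σ_*` of the `ℂ`-span of the
rational `(q,q)`-classes of `X'` (`σ_* = complexGysin μ`).

PROVED here CONDITIONALLY (`curveNetExists_of_hodgeModels_of_nonempty_curveNet`) on exactly two
inputs:

* `Literature.AlgebraicGeometry.Motives.nonempty_curveNet` — the named Literature fact (file
  `Literature/AlgebraicGeometry/Motives/CurveNetExistence`, relocated there by the gate from the first
  version of this file): every smooth projective complex `X` of dimension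
  `m + 1 ≥ 2` carries a CURVE NET `N : Motives.CurveNet m X` (Hartshorne II Example 7.17.3 +
  Bertini II Thm. 8.18 + the connectedness theorem, Hartshorne 1970 III Cor. 3.9 /
  Fulton–Hansen 1979); it supplies the witness `X' = N.total`, `σ = N.blowDown`, `pr = N.proj`
  and the surjectivity of `pr` (`CurveNet.surjective_proj`);
* the route's OWN support item `HodgeModels` (stmt-HodgeConjecture-3050, = the Literature named
  fact `nonempty_hodgeModel`): a Hodge model of the total space `X'`, without which no class of
  `X'` has a Hodge type in the tree's encoding (`IsOfHodgeType` quantifies `∃` over Hodge models).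

Everything else is PROVED (file `CurveNetMordellWeilCurveNetExistsTransfer`): the blow-down `σ` is a
homeomorphism of complex points over `X ∖ F`, so `σ(ℂ)_* [X̃(ℂ)] ≠ 0` (local degree at a point with
one-point fibre, Hatcher Thm. 3.26 / Prop. 2.30), `σ_* 1 = t • 1` with `t ≠ 0`, the projection
formula gives `σ_* σ^* c = t • c`, and `σ^* c` is a rational `(q,q)`-class of `X̃` (Voisin I §7.3.2,
`IsOfHodgeType.map_of_le`), whence `c = σ_* (t⁻¹ • σ^* c)`.

Why not unconditional: the tree's `SchemeOver ℂ`, `projectiveSpace`, `IsSmoothProjective` are the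
genuine Mathlib notions (`Over (Spec ℂ)`, `Proj ℂ[x₀,…,xₘ]`, smooth of relative dimension `n` +
closed immersion into some `ℙᴺ` + geometrically irreducible). `X' = X` is impossible in general
(`ℙⁿ` admits no surjection onto `ℙⁿ⁻¹`), so a witness is a genuine blow-up / incidence variety,
whose construction needs Bertini's theorem, global blow-ups (or bihomogeneous incidence schemes),
their smoothness and projectivity (Segre) — none of which Mathlib has. For the planner: the item is
equivalent, over the proved transfer, to the needs-fact `nonempty_curveNet` plus `HodgeModels`.
-/

noncomputable section

open CategoryTheory AlgebraicGeometry
open Literature.AlgebraicGeometry Literature.AlgebraicGeometry.HodgeTheory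

-- `Summit.HodgeConjecture.HodgeConjecture.Theorems` is the mandated namespace (single-conjunct summit:
-- Sub = Summit), which `linter.dupNamespace` flags on every declaration; the lakefile turns the
-- linter off tree-wide (weak option), restated here so stand-alone elaboration is warning-free too.
set_option linter.dupNamespace false

namespace Summit.HodgeConjecture.HodgeConjecture.Theorems

/-- **`CurveNetExists`, conditionally** on the existence of curve nets (`nonempty_curveNet`) and on
the route's own support item `HodgeModels` (a Hodge model of every smooth projective complex
variety, here of the total space of the net): the witness is the total space `X̃` of a curve net on
`X`, its blow-down `σ` and its net map `pr : X̃ → ℙᵐ` (surjective, `CurveNet.surjective_proj`); the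
inclusion of spans is the proved transfer `span_hodgeClasses_le_map_complexGysin_blowDown`
(`σ_* σ^* = t • id`, `t ≠ 0`, by the degree of the blow-down).
[cite: Hartshorne1977, II Example 7.17.3] [cite: VoisinHodgeI2002, §7.3.2] -/
theorem curveNetExists_of_hodgeModels_of_nonempty_curveNet
    (hModel : Summit.HodgeConjecture.HodgeConjecture.Theses.CurveNetMordellWeil.HodgeModels)
    (hN : Literature.AlgebraicGeometry.Motives.nonempty_curveNet) :
    Summit.HodgeConjecture.HodgeConjecture.Theses.CurveNetMordellWeil.CurveNetExists := by
  intro μ hμ n m X hX hn hmn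
  subst hmn
  obtain ⟨N⟩ := hN hX (by omega)
  obtain ⟨B⟩ := hModel N.isSmoothProjective_total
  exact ⟨N.total, N.isSmoothProjective_total, N.blowDown, N.proj, N.surjective_proj,
    fun q ↦ span_hodgeClasses_le_map_complexGysin_blowDown hμ hX N B q⟩

/-- The same, with the Hodge models supplied by the Literature named fact `nonempty_hodgeModel`
(Serre GAGA §2 + de Rham + Hodge decomposition; the route item `HodgeModels` is its verbatim
restatement) instead of the route item. [cite: VoisinHodgeI2002, Thm. 6.18]
[cite: Hartshorne1977, II Example 7.17.3] -/
theorem curveNetExists_of_nonempty_hodgeModel_of_nonempty_curveNet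
    (hModel : ∀ (n : ℕ) (Y : Literature.AlgebraicGeometry.Motives.SchemeOver ℂ),
      Literature.AlgebraicGeometry.HodgeTheory.nonempty_hodgeModel n Y)
    (hN : Literature.AlgebraicGeometry.Motives.nonempty_curveNet) :
    Summit.HodgeConjecture.HodgeConjecture.Theses.CurveNetMordellWeil.CurveNetExists :=
  curveNetExists_of_hodgeModels_of_nonempty_curveNet (fun _ _ hY ↦ hModel _ _ hY) hN

end Summit.HodgeConjecture.HodgeConjecture.Theorems

end
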